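import Summits.HodgeConjecture.HodgeConjecture.Theses.GenericDivisibility
import Summits.HodgeConjecture.HodgeConjecture.Theorems.LimitExtensionDivisorInduction
import Literature.AlgebraicGeometry.HodgeTheory.ComplexConjugationHolds
import Literature.AlgebraicGeometry.HodgeTheory.PencilStepBelowMiddleHolds
import Literature.AlgebraicGeometry.HodgeTheory.HardLefschetzNFoldHolds
import Literature.AlgebraicGeometry.HodgeTheory.RationalLatticeIntegral
import Literature.AlgebraicGeometry.HodgeTheory.IntegralClassesCountable

/-!
# Route GenericDivisibility — `Assembly` (assembly item stmt-HodgeConjecture-18470)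

The assembly item of route `GenericDivisibility`:

  HodgeClassesGenericallyDivisible → GenericDivisibilityBounded → HodgeConjecture,

i.e. the two cruxes C1 (middle-degree integral classes with complexification of Hodge type `(p, p)`
on a smooth projective complex `2p`-fold are divisible by every `m ≥ 1` on non-empty Zariski opens)
and C2 (integral middle-degree classes so divisible have complexification of coniveau `≥ 1`) imply
the Hodge conjecture.

Proof: the route's deciding theorem `GenericDivisibility.closes` (strong induction on the dimension:
Hodge models; Lefschetz pencils below the middle; hard Lefschetz above the middle; in the middle
degree the two cruxes give coniveau `≥ 1` and divisor induction gives algebraicity) takes, besides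
the two cruxes, five support hypotheses, each discharged here from the tree (the same one-line
arguments as the items' own closing files `GenericDivisibility{MiddleConiveauOne, HodgeModelsExist,
PencilReduction, HardLefschetzReduction}.lean`, re-derived inline against the Literature theorems so
that this file depends only on built Literature modules and the shared `DivisorInduction` proof):

* `MiddleConiveauOne` (stmt-HodgeConjecture-18468) — an integral multiple `N • c` of a rational
  class (`IsRationalClass.exists_nsmul_isIntegralClass`,
  `isIntegralClass_iff_mem_range_ringChange`), C1 then C2 on the integral lift, division by `N`
  in the `ℂ`-submodule `N¹ = supportedClasses X (2p) 1`;
* `HodgeModelsExist` (stmt-HodgeConjecture-18143) — `nonempty_hodgeModel_holds` (Serre GAGA +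
  de Rham + the Hodge decomposition);
* `DivisorInduction` (stmt-HodgeConjecture-18851) — the shared item stmt-HodgeConjecture-1082,
  proved unconditionally as `limitExtension_divisorInduction_proof` (Deligne Hodge III
  8.2.7/8.2.8 for snc boundaries, Gysin lift, push-forward); this route's copy of the decl unfolds
  to the same proposition, so the transfer is `unfold; exact`;
* `PencilReduction` (stmt-HodgeConjecture-18852) — `mem_algebraicClasses_of_two_mul_le` (Thomas 2005
  Prop. 2 / de Cataldo–Migliorini 2009 Prop. 4.5; the codimension-`p - 1` hypothesis is unused);
* `HardLefschetzReduction` (stmt-HodgeConjecture-18853) —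
  `HardLefschetzNFold.mem_algebraicClasses_of_lt_holds` (Voisin I Thm. 6.25).

No definitions, no named-fact hypotheses, no sorry: the theorem is unconditional in C1 and C2.
-/

-- `Summit.HodgeConjecture.HodgeConjecture.Theorems` is the mandated namespace (single-problem
-- summit: Problem = Summit), which `linter.dupNamespace` flags on every declaration; the lakefile
-- turns the linter off tree-wide (weak option), restated here so stand-alone elaboration is
-- warning-free too.
set_option linter.dupNamespace false

noncomputable section

namespace Summit.HodgeConjecture.HodgeConjecture.Theorems

open Literature.AlgebraicGeometry.Motives Literature.AlgebraicGeometry.HodgeTheory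
  Literature.AlgebraicTopology.SingularHomology

/-- **Item stmt-HodgeConjecture-18470 (`Assembly`), route `GenericDivisibility`**: the two cruxes
`HodgeClassesGenericallyDivisible` (C1) and `GenericDivisibilityBounded` (C2) imply the Hodge
conjecture — the route's deciding theorem `GenericDivisibility.closes` (strong induction on the
dimension: Hodge models, Lefschetz pencils below the middle, hard Lefschetz above it, and in the
middle degree coniveau `≥ 1` from C1 + C2 followed by divisor induction) fed with proofs of its
five support hypotheses: `MiddleConiveauOne` (integral multiple, C1 then C2, division in `N¹`),
`HodgeModelsExist` (`nonempty_hodgeModel_holds`), `DivisorInduction` (shared item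
stmt-HodgeConjecture-1082, `limitExtension_divisorInduction_proof`, the same proposition as this
route's copy), `PencilReduction` (`mem_algebraicClasses_of_two_mul_le`) and `HardLefschetzReduction`
(`HardLefschetzNFold.mem_algebraicClasses_of_lt_holds`).  The type is literally the route decl
`Summit.HodgeConjecture.HodgeConjecture.Theses.GenericDivisibility.Assembly`.
[cite: DeligneHodgeIII1974, Prop. 8.2.7 and Cor. 8.2.8]
[cite: DecataldoMigliorini2009, §4 Prop. 4.5] [cite: VoisinHodgeI2002, Thm. 6.25 and §7.1.1]
[cite: Thomas2005Nodes, §2 Prop. 2] [cite: SerreGAGA1956, §2 n°5 Prop. 2]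
[cite: HatcherAT2002, §3.1 Thm. 3.2] -/
theorem genericDivisibility_assembly_proof :
    Summit.HodgeConjecture.HodgeConjecture.Theses.GenericDivisibility.Assembly := by
  unfold Summit.HodgeConjecture.HodgeConjecture.Theses.GenericDivisibility.Assembly
  intro h1 h2
  -- `MiddleConiveauOne` (stmt-18468): integral multiple, C1 then C2, divide in the submodule `N¹`
  have h3 :
      Summit.HodgeConjecture.HodgeConjecture.Theses.GenericDivisibility.MiddleConiveauOne := by
    unfold Summit.HodgeConjecture.HodgeConjecture.Theses.GenericDivisibility.MiddleConiveauOne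
    intro h1 h2 p X hp hX c hc hpp
    obtain ⟨N, hN, hNc⟩ := hc.exists_nsmul_isIntegralClass hX
    obtain ⟨z, hz⟩ := (isIntegralClass_iff_mem_range_ringChange _).1 hNc
    have hzpp : IsOfHodgeType (2 * p) X (2 * p) p p
        (singularCohomology.ringChange (Int.castRingHom ℂ) (ComplexPoints X) (2 * p) z) := by
      rw [hz]
      obtain ⟨A, hA⟩ := hpp
      exact ⟨A, by rw [map_smul]; exact Submodule.smul_mem _ _ hA⟩
    have hmem : singularCohomology.ringChange (Int.castRingHom ℂ) (ComplexPoints X) (2 * p) z ∈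
        supportedClasses X (2 * p) 1 :=
      h2 hp hX z (h1 hp hX z hzpp)
    rw [hz] at hmem
    have hN' : (N : ℂ) ≠ 0 := Nat.cast_ne_zero.2 hN.ne'
    have hc' : (N : ℂ)⁻¹ • ((N : ℂ) • c) ∈ supportedClasses X (2 * p) 1 :=
      Submodule.smul_mem _ _ hmem
    rwa [smul_smul, inv_mul_cancel₀ hN', one_smul] at hc'
  -- `HodgeModelsExist` (stmt-18143): Serre GAGA + de Rham + Hodge decomposition
  have hM : Summit.HodgeConjecture.HodgeConjecture.Theses.GenericDivisibility.HodgeModelsExist := by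
    unfold Summit.HodgeConjecture.HodgeConjecture.Theses.GenericDivisibility.HodgeModelsExist
    intro n X hX
    exact nonempty_hodgeModel_holds hX
  -- `DivisorInduction`: this route's copy of the shared item stmt-1082 is the same proposition
  have hDiv :
      Summit.HodgeConjecture.HodgeConjecture.Theses.GenericDivisibility.DivisorInduction := by
    unfold Summit.HodgeConjecture.HodgeConjecture.Theses.GenericDivisibility.DivisorInduction
    exact limitExtension_divisorInduction_proof
  -- `PencilReduction` (stmt-18852): the unconditional pencil step below the middle
  have hP : Summit.HodgeConjecture.HodgeConjecture.Theses.GenericDivisibility.PencilReduction := by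
    unfold Summit.HodgeConjecture.HodgeConjecture.Theses.GenericDivisibility.PencilReduction
    intro m p _ hpm hHC _ X hX c hc hpp
    exact mem_algebraicClasses_of_two_mul_le hX hHC p c hpm hc hpp
  -- `HardLefschetzReduction` (stmt-18853): hard Lefschetz for the rational hyperplane class
  have hHL :
      Summit.HodgeConjecture.HodgeConjecture.Theses.GenericDivisibility.HardLefschetzReduction := by
    unfold Summit.HodgeConjecture.HodgeConjecture.Theses.GenericDivisibility.HardLefschetzReduction
    intro n p hnp X hX hyp c hc hpp
    exact HardLefschetzNFold.mem_algebraicClasses_of_lt_holds hX hnp hyp c hc hpp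
  exact Summit.HodgeConjecture.HodgeConjecture.Theses.GenericDivisibility.closes h1 h2 h3 hM hDiv
    hP hHL

end Summit.HodgeConjecture.HodgeConjecture.Theorems

end
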